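/-
COR-CM (cell pub-hodgecm2, stage 2 of the Hodge ladder) — count-neutral KERNEL COMBINATORICS «field level of SMALL DEGREES: every Galois CM field of degree
4p, of degree 2ᵏ ≤ 8, and hence EVERY Galois CM field of degree < 16 has EXACTLY φ₂(F) generating faces» (seat prover-pub-hodgecm2-b23-g50-0, binder
prover b23, gen 50; own census lane INDEX-TWO CYCLIC 2-GROUPS, extension «SMALL DEGREES», claim HOME/INBOX.md l.23042, INTERIM #1 l.23124).  Theorems only;
`Census/IndexTwoCyclicOddPrime.lean`, `Census/IndexTwoCyclicOrderEight.lean` (this seat), seat b23 gen 40ʼs odd half-degree field law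
(`CorCM/FaceComplementImaginaryQuadratic.lean`), the field transfer `CorCM/FaceGenerationTransfer.lean` and the INT2-GEN socket are used BY NAME; nothing
asserted.  `Interfaces.lean` (C1), every E term, B01, `Transposition/*`, `PortJoin/*`, `D2Bridge/*` untouched.
HONEST FRAMING: `HC_CM` is NOT proved, here or anywhere in the tree; this file produces no period and proves no face period for any field; §2 is
CONDITIONAL on the face periods exactly as the earlier sockets.
T5: n/a-class (hypothesis binders: `[F:ℚ] = 4p` / `2ᵏ (k ≤ 3)` / `< 16` — inhabited by `ℚ(ζ₇, i)`-type fields, `ℚ(ζ₁₆)`, …; checker: self, 2026-08-25).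
-/
import Summits.HodgeConjecture.CorCM.Census.IndexTwoCyclicOddPrime
import Summits.HodgeConjecture.CorCM.Census.IndexTwoCyclicOrderEight
import Summits.HodgeConjecture.CorCM.FaceIndexTwoCyclicTwoGroups
import Summits.HodgeConjecture.CorCM.FaceComplementImaginaryQuadratic
import Summits.HodgeConjecture.CorCM.FaceCoinvariantOddHalf
import HarnessLib

/-!
# Field level, small degrees: every Galois CM field of degree `< 16` has exactly `φ₂(F)` generating faces

The face census `μ = φ₂` (the least number of faces whose Galois conjugates generate the Lefschetz/Hodge lattice modulo divisor classes equals
André-3ʼs coinvariant fibre dimension) is now a theorem for the following classes of Galois CM fields `F`, with NO hypothesis on the Galois group: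

* `[F:ℚ] ≡ 2 (mod 4)` — seat b23 gen 40 (`CorCM/FaceComplementImaginaryQuadratic.lean`, odd half-degree; complex conjugation is complemented);
* `[F:ℚ] = 4p`, `p` an odd prime — §1 `isLeast_card_faces_hgen_of_finrank_eq_four_mul_prime` (`Census/IndexTwoCyclicOddPrime.lean`: Cauchy puts
  conjugation in a cyclic subgroup of index two; level-`p` trichotomy);
* `[F:ℚ] = 2ᵏ ≤ 8` — §1 `isLeast_card_faces_hgen_of_finrank_two_pow_le_eight` (`Census/IndexTwoCyclicOrderEight.lean`);
* `[F:ℚ] = 2ᵏ` cyclic over a quadratic subfield — `CorCM/FaceIndexTwoCyclicTwoGroups.lean`.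

In particular (§1 **`isLeast_card_faces_hgen_of_finrank_lt_sixteen`**): **EVERY Galois CM field of degree `< 16` has EXACTLY `φ₂(F)` generating faces**
(degrees `2, 4, 6, 8, 10, 12, 14`), and more generally **`isLeast_card_faces_hgen_of_finrank_lt_twentyfour`**: every Galois CM field of degree `< 24`
other than `16` (the first open degree: `D₄ × ℤ/2`, `Q₈ × ℤ/2`, the Pauli group, …; then `24`).  §2 records the CONDITIONAL
Hodge-conjecture readings through the INT2-GEN socket.  `HC_CM` is NOT proved.

## References
* [Pohlmann1968] H. Pohlmann, Algebraic cycles on abelian varieties of complex multiplication type, Ann. of Math. 88 (1968), Thm 1.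
* [Shimura1998] G. Shimura, Abelian Varieties with Complex Multiplication and Modular Functions, §6.2 Thm. 3, §8.1.
-/

noncomputable section

open CategoryTheory NumberField NumberField.ComplexEmbedding
open Literature.AlgebraicGeometry Literature.AlgebraicGeometry.Motives Literature.AlgebraicGeometry.HodgeTheory
open Literature.AlgebraicGeometry.ComplexMultiplication Literature.AlgebraicGeometry.Milne1999
open Literature.NumberTheory.Automorphic
open Literature.NumberTheory.Automorphic.PicardCM
open Summit.HodgeConjecture.CorCM.Domination

namespace Summit.HodgeConjecture.CorCM.FaceIndexTwoCyclic

open Summit.HodgeConjecture.CorCM.Prior.AllgGroup.RfwfAllgGroup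
open Summit.HodgeConjecture.CorCM.Census.BlockParity
open Summit.HodgeConjecture.CorCM.Census.Coinvariant
open Summit.HodgeConjecture.CorCM.Census

section Field

variable {F : Type} [Field F] [NumberField F]

/-! ## §1 Exactly `φ₂(F)` generating faces -/

/-- Transfer of an intrinsic `μ = φ₂` law on the Galois translates to the face sets of `F` (file-local wrapper of `CorCM/FaceGenerationTransfer.lean`).
[folklore] -/
private theorem isLeast_faces_of_isLeast_gfaces [IsCMField F] [IsGalois ℚ F]
    (h : IsLeast {m : ℕ | ∃ S : Finset (CMF (GalT F) conjT →₀ ℤ), ↑S ⊆ gfaceSet (GalT F) conjT conjT_mul_self ∧ S.card = m ∧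
      hodgeSpan (conjT : GalT F) conjT_mul_self ≤ Submodule.span ℤ (pairSet (conjT : GalT F)) ⊔ Submodule.span ℤ (translates conjT S)}
      (fibreTwo (conjT : GalT F) conjT_mul_self)) (σ₀ : F →+* ℂ) :
    IsLeast {m : ℕ | ∃ 𝒮 : Finset (Face F), 𝒮.card = m ∧
      ∀ f : Face F, lefChar f.corner (fun _ => ({σ₀} : Finset (F →+* ℂ))) ∈ AddSubgroup.closure
        {a : Asym F | ∃ g ∈ (𝒮 : Set (Face F)), ∃ σ : F →+* ℂ, a = lefChar g.corner (fun _ => ({σ} : Finset (F →+* ℂ)))}}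
      (fibreTwo (conjT : GalT F) conjT_mul_self) := by
  refine FaceTransfer.isLeast_card_faces_hgen_of_intrinsic _ ?_ (fun S₀ hS₀ hS => ?_) σ₀
  · obtain ⟨S, hS, hcard, hgen⟩ := h.1
    exact ⟨S, hS, hcard.le, hgen⟩
  · exact fibreTwo_le_card conjT conjT_mul_self FaceBasis.conjT_comm S₀ (Submodule.span ℤ (pairSet conjT)) le_rfl hS₀
      (fun y hy => hS (gfaceSet_subset_hodgeSpan conjT conjT_mul_self hy))

/-- **EVERY GALOIS CM FIELD OF DEGREE `4p` (`p` AN ODD PRIME) HAS EXACTLY `φ₂(F)` GENERATING FACES** — Galois group `ℤ/4p`, `ℤ/2p × ℤ/2`, `D_{4p}` or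
`Q_{4p}`, complex conjugation any central involution; no hypothesis beyond the degree. [folklore] -/
theorem isLeast_card_faces_hgen_of_finrank_eq_four_mul_prime [IsCMField F] [IsGalois ℚ F] {p : ℕ} (hp : p.Prime) (hp2 : p ≠ 2)
    (hdeg : Module.finrank ℚ F = 4 * p) (σ₀ : F →+* ℂ) :
    IsLeast {m : ℕ | ∃ 𝒮 : Finset (Face F), 𝒮.card = m ∧
      ∀ f : Face F, lefChar f.corner (fun _ => ({σ₀} : Finset (F →+* ℂ))) ∈ AddSubgroup.closure
        {a : Asym F | ∃ g ∈ (𝒮 : Set (Face F)), ∃ σ : F →+* ℂ, a = lefChar g.corner (fun _ => ({σ} : Finset (F →+* ℂ)))}}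
      (fibreTwo (conjT : GalT F) conjT_mul_self) :=
  isLeast_faces_of_isLeast_gfaces (IndexTwoCyclic.isLeast_card_gfaces_generate_fibreTwo_of_card_eq_four_mul_prime conjT_mul_self conjT_ne_one
    FaceBasis.conjT_comm hp hp2 ((FaceCensus.card_galT (F := F)).trans hdeg)) σ₀

/-- **EVERY GALOIS CM FIELD OF DEGREE `2`, `4` OR `8` HAS EXACTLY `φ₂(F)` GENERATING FACES** (any Galois group of that order, conjugation any central
involution). [folklore] -/
theorem isLeast_card_faces_hgen_of_finrank_two_pow_le_eight [IsCMField F] [IsGalois ℚ F] {k : ℕ} (hdeg : Module.finrank ℚ F = 2 ^ k) (hk : k ≤ 3)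
    (σ₀ : F →+* ℂ) :
    IsLeast {m : ℕ | ∃ 𝒮 : Finset (Face F), 𝒮.card = m ∧
      ∀ f : Face F, lefChar f.corner (fun _ => ({σ₀} : Finset (F →+* ℂ))) ∈ AddSubgroup.closure
        {a : Asym F | ∃ g ∈ (𝒮 : Set (Face F)), ∃ σ : F →+* ℂ, a = lefChar g.corner (fun _ => ({σ} : Finset (F →+* ℂ)))}}
      (fibreTwo (conjT : GalT F) conjT_mul_self) :=
  isLeast_faces_of_isLeast_gfaces (IndexTwoCyclic.isLeast_card_gfaces_generate_fibreTwo_of_card_two_pow_le_eight conjT_mul_self conjT_ne_one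
    FaceBasis.conjT_comm ((FaceCensus.card_galT (F := F)).trans hdeg) hk) σ₀

/-- The degree of a Galois CM field is even (complex conjugation has order two in the Galois translates). [folklore] -/
theorem two_dvd_finrank [IsCMField F] [IsGalois ℚ F] : 2 ∣ Module.finrank ℚ F := by
  have h2 : orderOf (conjT : GalT F) = 2 := orderOf_eq_prime (by rw [pow_two]; exact conjT_mul_self) conjT_ne_one
  rw [← FaceCensus.card_galT (F := F), ← h2]
  exact orderOf_dvd_card

/-- **EVERY GALOIS CM FIELD OF DEGREE `< 16` HAS EXACTLY `φ₂(F)` GENERATING FACES** — degrees `2, 6, 10, 14` by seat b23 gen 40ʼs odd half-degree law,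
`4, 8` by the 2-group laws, `12 = 4·3` by the `4p` law; no hypothesis on the Galois group. [folklore] -/
theorem isLeast_card_faces_hgen_of_finrank_lt_sixteen [IsCMField F] [IsGalois ℚ F] (h16 : Module.finrank ℚ F < 16) (σ₀ : F →+* ℂ) :
    IsLeast {m : ℕ | ∃ 𝒮 : Finset (Face F), 𝒮.card = m ∧
      ∀ f : Face F, lefChar f.corner (fun _ => ({σ₀} : Finset (F →+* ℂ))) ∈ AddSubgroup.closure
        {a : Asym F | ∃ g ∈ (𝒮 : Set (Face F)), ∃ σ : F →+* ℂ, a = lefChar g.corner (fun _ => ({σ} : Finset (F →+* ℂ)))}}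
      (fibreTwo (conjT : GalT F) conjT_mul_self) := by
  have hpos : 0 < Module.finrank ℚ F := Module.finrank_pos
  obtain ⟨d', hd'⟩ := two_dvd_finrank (F := F)
  rcases (show Module.finrank ℚ F / 2 % 2 = 1 ∨ Module.finrank ℚ F = 2 ^ 2 ∨ Module.finrank ℚ F = 2 ^ 3 ∨ Module.finrank ℚ F = 4 * 3 by omega)
    with h | h | h | h
  · have hodd : Odd (Module.finrank ℚ F / 2) := Nat.odd_iff.mpr h
    have hlaw := FaceComplement.isLeast_card_faces_hgen_of_odd hodd σ₀
    have hβ := FaceCoinvariant.fibreTwo_add_one_eq_card_block_of_odd_finrank_div_two (F := F) hodd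
    rwa [show Fintype.card (Block (conjT : GalT F)) - 1 = fibreTwo (conjT : GalT F) conjT_mul_self by omega] at hlaw
  · exact isLeast_card_faces_hgen_of_finrank_two_pow_le_eight h (by norm_num) σ₀
  · exact isLeast_card_faces_hgen_of_finrank_two_pow_le_eight h le_rfl σ₀
  · exact isLeast_card_faces_hgen_of_finrank_eq_four_mul_prime Nat.prime_three (by norm_num) h σ₀

/-- **EVERY GALOIS CM FIELD OF DEGREE `< 24` OTHER THAN `16` HAS EXACTLY `φ₂(F)` GENERATING FACES** — degrees `2, 6, 10, 14, 18, 22` by the odd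
half-degree law, `4, 8` by the 2-group laws, `12 = 4·3` and `20 = 4·5` by the `4p` law; no hypothesis on the Galois group.  (Degree `16` is the first open
degree: `D₄ × ℤ/2` and `Q₈ × ℤ/2` with conjugation in the Frattini subgroup, the Pauli group, `ℤ/4 ⋊ ℤ/4` off the dicyclic involution, ….) [folklore] -/
theorem isLeast_card_faces_hgen_of_finrank_lt_twentyfour [IsCMField F] [IsGalois ℚ F] (h24 : Module.finrank ℚ F < 24)
    (h16 : Module.finrank ℚ F ≠ 16) (σ₀ : F →+* ℂ) :
    IsLeast {m : ℕ | ∃ 𝒮 : Finset (Face F), 𝒮.card = m ∧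
      ∀ f : Face F, lefChar f.corner (fun _ => ({σ₀} : Finset (F →+* ℂ))) ∈ AddSubgroup.closure
        {a : Asym F | ∃ g ∈ (𝒮 : Set (Face F)), ∃ σ : F →+* ℂ, a = lefChar g.corner (fun _ => ({σ} : Finset (F →+* ℂ)))}}
      (fibreTwo (conjT : GalT F) conjT_mul_self) := by
  have hpos : 0 < Module.finrank ℚ F := Module.finrank_pos
  obtain ⟨d', hd'⟩ := two_dvd_finrank (F := F)
  rcases (show Module.finrank ℚ F / 2 % 2 = 1 ∨ Module.finrank ℚ F = 2 ^ 2 ∨ Module.finrank ℚ F = 2 ^ 3 ∨ Module.finrank ℚ F = 4 * 3 ∨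
      Module.finrank ℚ F = 4 * 5 by omega) with h | h | h | h | h
  · have hodd : Odd (Module.finrank ℚ F / 2) := Nat.odd_iff.mpr h
    have hlaw := FaceComplement.isLeast_card_faces_hgen_of_odd hodd σ₀
    have hβ := FaceCoinvariant.fibreTwo_add_one_eq_card_block_of_odd_finrank_div_two (F := F) hodd
    rwa [show Fintype.card (Block (conjT : GalT F)) - 1 = fibreTwo (conjT : GalT F) conjT_mul_self by omega] at hlaw
  · exact isLeast_card_faces_hgen_of_finrank_two_pow_le_eight h (by norm_num) σ₀
  · exact isLeast_card_faces_hgen_of_finrank_two_pow_le_eight h le_rfl σ₀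
  · exact isLeast_card_faces_hgen_of_finrank_eq_four_mul_prime Nat.prime_three (by norm_num) h σ₀
  · exact isLeast_card_faces_hgen_of_finrank_eq_four_mul_prime Nat.prime_five (by norm_num) h σ₀

end Field

/-! ## §2 The Hodge-conjecture readings through the INT2-GEN socket (conditional on the face periods) -/

/-- **HC for the slice of a Galois CM field of degree `4p` (`p` an odd prime), from `φ₂(K)` face periods** (INT2-GEN socket BY NAME; CONDITIONAL on the
periods — `HC_CM` is NOT proved; no hypothesis on the Galois group). [cite: Shimura1998, §6.2 Theorem 3 and §6.1 Corollary of Theorem 2 (pp. 41–43)]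
[cite: Pohlmann1968, Thm. 1] [cite: Milne1999LefschetzClasses, Thm. 3.2 and Cor. 4.5] [cite: MumfordAV1970, §19 Thm. 1 and p. 169] -/
theorem hodgeConjectureFor_of_finrank_eq_four_mul_prime_of_exists_facePeriod (K : CMField) [hGal : IsGalois ℚ K] {p : ℕ} (hp : p.Prime)
    (hp2 : p ≠ 2) (hdeg : Module.finrank ℚ K = 4 * p) (σ₀ : (K : Type) →+* ℂ) :
    ∃ 𝒮 : Finset (Face K), 𝒮.card = fibreTwo (conjT : GalT K) conjT_mul_self ∧
      ((∀ f ∈ 𝒮, ∃ ι₁ : K →+* ℂ, f.Admissible ι₁ ∧ ∃ (V : HermSpace3 K ι₁) (σ : K →+* ℂ),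
        (Model.picardCMUniverse exists_isReal_hodgeModel_holds hodgePQ_independent_of_hodgeModel_holds
          BallQuotient.ballQuotientUniformised_holds cmAbelianVarietyRealised_holds).PeriodNV ι₁ V K f.psi σ) →
      ∀ {P B : AbelianVariety ℂ}, AbelianVariety.IsProductOf (fun B : AbelianVariety ℂ =>
        ∃ (E : Type) (_ : Field E) (_ : NumberField E) (_ : IsCMField E) (_ : E →+* (K : Type)) (Φ : CMType E)
          (ι : 𝓞 E →+* End B) (ϑ : E →+* Module.End ℂ (complexBetti B.X 1)),
          IsCMTypeRealisation Φ B ι ϑ) P →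
      AVDominatedBy B P → HodgeConjectureFor B.dim B.X) := by
  obtain ⟨⟨𝒮, hcard, hgen⟩, -⟩ := isLeast_card_faces_hgen_of_finrank_eq_four_mul_prime (F := K) hp hp2 hdeg σ₀
  refine ⟨𝒮, hcard, fun h P B hP hB => ?_⟩
  have h6 : 6 ≤ Module.finrank ℚ K := by
    rw [hdeg]
    have := hp.two_le
    omega
  exact hodgeConjectureFor_of_avDominatedBy_isProductOf_of_exists_facePeriod_on K h6 (𝒮 : Set (Face K)) σ₀ hgen
    (fun f hf => h f (Finset.mem_coe.mp hf)) hP hB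

/-- **HC for the slice of ANY Galois CM field of degree `6 ≤ [K:ℚ] < 16`, from `φ₂(K)` face periods** (INT2-GEN socket BY NAME; CONDITIONAL on the
periods — `HC_CM` is NOT proved; no hypothesis on the Galois group): a face set with `|𝒮| = φ₂(K)` EXISTS (none smaller satisfies the generation binder)
such that ONE period witness per face of `𝒮` on the universe of record implies the Hodge conjecture for every abelian variety dominated by a product of CM
abelian varieties with CM by subfields of `K`. [cite: Shimura1998, §6.2 Theorem 3 and §6.1 Corollary of Theorem 2 (pp. 41–43)] [cite: Pohlmann1968, Thm. 1]
[cite: Milne1999LefschetzClasses, Thm. 3.2 and Cor. 4.5] [cite: MumfordAV1970, §19 Thm. 1 and p. 169] -/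
theorem hodgeConjectureFor_of_finrank_lt_sixteen_of_exists_facePeriod (K : CMField) [hGal : IsGalois ℚ K] (h6 : 6 ≤ Module.finrank ℚ K)
    (h16 : Module.finrank ℚ K < 16) (σ₀ : (K : Type) →+* ℂ) :
    ∃ 𝒮 : Finset (Face K), 𝒮.card = fibreTwo (conjT : GalT K) conjT_mul_self ∧
      ((∀ f ∈ 𝒮, ∃ ι₁ : K →+* ℂ, f.Admissible ι₁ ∧ ∃ (V : HermSpace3 K ι₁) (σ : K →+* ℂ),
        (Model.picardCMUniverse exists_isReal_hodgeModel_holds hodgePQ_independent_of_hodgeModel_holds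
          BallQuotient.ballQuotientUniformised_holds cmAbelianVarietyRealised_holds).PeriodNV ι₁ V K f.psi σ) →
      ∀ {P B : AbelianVariety ℂ}, AbelianVariety.IsProductOf (fun B : AbelianVariety ℂ =>
        ∃ (E : Type) (_ : Field E) (_ : NumberField E) (_ : IsCMField E) (_ : E →+* (K : Type)) (Φ : CMType E)
          (ι : 𝓞 E →+* End B) (ϑ : E →+* Module.End ℂ (complexBetti B.X 1)),
          IsCMTypeRealisation Φ B ι ϑ) P →
      AVDominatedBy B P → HodgeConjectureFor B.dim B.X) := by
  obtain ⟨⟨𝒮, hcard, hgen⟩, -⟩ := isLeast_card_faces_hgen_of_finrank_lt_sixteen (F := K) h16 σ₀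
  refine ⟨𝒮, hcard, fun h P B hP hB => ?_⟩
  exact hodgeConjectureFor_of_avDominatedBy_isProductOf_of_exists_facePeriod_on K h6 (𝒮 : Set (Face K)) σ₀ hgen
    (fun f hf => h f (Finset.mem_coe.mp hf)) hP hB

end Summit.HodgeConjecture.CorCM.FaceIndexTwoCyclic
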